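import Summits.Ventures.QEC.Census.CertChunks
import Summits.Ventures.QEC.Census.LP.LP36w5.KernelZ01
import HarnessLib

/-!
# `LP36w5` — KERNEL-tier lower-bound replay, side Z: assembly (emitted by qec-search-7)

From the leaf files `KernelZ01 … KernelZ01` (packed chunks, each `decide +kernel`) this file assembles, by
first-order terms only (lemmas of `Census/CertChunks.lean`: `reaches_chunk1_of_chunk2`, `reaches_origin_of_chunk1`,
`forall_lt_append`, `forall_lt_single`, `forall_of_chunk1R`, `forall_of_chunk2R`), the statement

  `Reaches (leafTest [1090781187, 34904997921, 2181562374, 4363124748, 8726249496, 17452498992, 17247240384, 8631879744, 34494480768, 1343226624, 2686453248, 4315941888, 4563677184, 2290225152, 9127354368, 17197744128, 34395488256, 1145241600]) (posList 36 cert.HX) 5 0 0`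

i.e. the bruteforce replay of budget `5` over all 36 positions of side Z reached every support of weight `≤ 5` with
its true syndrome and found it nonzero-syndrome, empty, or allow-listed (= what `scan … = true` would give in one
evaluation, `CertScan.reaches_of_scan`; the soundness step to `dZ = 6` is type-10's, file `LP/LP36w5/Distance.lean`).
Chunk plan: first positions `i < 0` split at level 2 (second position), `i ≥ 0` at level 1; cap 200000 end points per
kernel evaluation; 3 evaluations; 443703 end points in total. Tier KERNEL (CERTIFIED).
-/

namespace Summit.Ventures.QEC.Census.LP36w5

/-- **Side Z of `LP36w5`, tier KERNEL**: the bruteforce replay of budget 5 over all 36 positions reaches every support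
of weight `≤ 5` (nonzero syndrome, or empty, or allow-listed). -/
theorem reachesZ : Reaches (leafTest [1090781187, 34904997921, 2181562374, 4363124748, 8726249496, 17452498992, 17247240384, 8631879744, 34494480768, 1343226624, 2686453248, 4315941888, 4563677184, 2290225152, 9127354368, 17197744128, 34395488256, 1145241600]) (posList 36 cert.HX) 5 0 0 :=
  reaches_origin_of_chunk1 36 (by decide +kernel) (by decide +kernel)
    (forall_lt_append (forall_lt_append (forall_lt_append (forall_lt_zero) (forall_of_chunk1R kZ1_0)) (forall_of_chunk1R kZ1_3)) (forall_of_chunk1R kZ1_9))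

end Summit.Ventures.QEC.Census.LP36w5
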